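import Mathlib
import HarnessLib
import Summits.NavierStokesRegularity.NavierStokesRegularity.Theorems.PoloidalWindowDoorLrcModEntireCurvedSheetSpeedLaw

/-!
# Route `PoloidalWindowDoor`, item `LrcModEntire` (stmt-NavierStokesRegularity-20428), cell (Q4-curved), v16 child «VERTICAL» —
# ORDER 1 OF VERT-PROP: on a vertical critical cylinder the web speed is `Uₕ·ν` (kernel brick P2 of `Cruxes/LrcModEntire/VERT-PROP-g18.md` §3/§5)

Cell ns-regularity-ideate, helper seat ns-k2-port-2 g9 under the LEAD of item 20428 (ns-poloidal-K2-p3 g18, assignment P2 2026-08-30T02:05:23Z);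
`--supports stmt-NavierStokesRegularity-20428 --as helper`.  CLASS LEVEL, at the hot time `t = −1`, over a planar unit-speed `C²` branch `Γ` with Frenet curvature
`k`, on the (TH) slab `|z| < ρ`, under the V-ENTRANCE output (E1) of `…Q4CurvedVerticalEntrance.vertical_entrance` restricted to the slab («the cylinder `Γ × (−ρ, ρ)` is
horizontally critical for `θ := U₂(−1,·)`»):

* ★ `vertical_cylinder_jets` — the jets of `θ` at a cylinder point `P = Γ s + z·e₂` (ν = JΓ′(s), T = Γ′(s)): `D²θ[T,ν] = 0`, `D²θ[T,T] = 0`, `D²θ[e₂,ν] = 0`,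
  `D³θ[ν,T,T] = −k(s)·D²θ[ν,ν]`, `D³θ[ν,e₂,e₂] = 0`, and — where `μ(−1,z) ≠ 0` — `D³θ[ν,T,T] + D³θ[ν,ν,ν] = 0`, i.e. `D³θ[ν,ν,ν] = k(s)·D²θ[ν,ν]`
  (B-JETc `…CurvedSheetJet.curved_sheet_jet` with the offset `d ≡ 0`, plus two `z`-derivatives of (E1) along the vertical line and the slot symmetries of `D³θ`).
* ★★ `vertical_order_one` — ORDER 1: `∂_ν(∂_tU₂)(P) = −(Uₕ·ν)(P) · D²θ(P)[ν,ν]` where `μ(−1,z) ∉ {0, 1}` (B-SPEEDc `…CurvedSheetSpeedLaw.curved_sheet_normalDeriv_timeDeriv`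
  with `d ≡ 0` + the jets above): the `(1 − μ)`-term `D³θ[ν,ν,ν] − k·D²θ[ν,ν]` VANISHES on the cylinder.  With the kinematic identity of a time web
  (`∂_ν∂_tU₂ + V·D²θ[ν,ν] = 0`, `D²θ[ν,ν] ≠ 0`) this is «web speed `V = Uₕ·ν`», `z`-free by (E3) — VERT-PROP §3 ORDER 1.

WHAT THIS IS NOT: not a claim about Navier–Stokes regularity; closes nothing (kernel brick for the RESEARCH slot `stub_Q4curvedAperiodicVertical`);
items 20428 / 19708 / 27893 OPEN (bears_on LADDER-NS N0).
-/

noncomputable section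

set_option linter.dupNamespace false
set_option linter.style.longLine false

namespace Summit.NavierStokesRegularity.NavierStokesRegularity.Theorems.PoloidalWindowDoorLrcModEntireQ4CurvedVerticalOrderOne

open Set Function Filter Topology Metric
open scoped RealInnerProductSpace InnerProductSpace Laplacian ContDiff
open Literature.Analysis Literature.Analysis.FluidPDE Literature.Analysis.UnboundedOperators
open Summit.NavierStokesRegularity.NavierStokesRegularity.Theorems
open Summit.NavierStokesRegularity.NavierStokesRegularity.Theorems.LocalSineTubeDoorProfileAlignedWindowRigidityAncient
open Summit.NavierStokesRegularity.NavierStokesRegularity.Theorems.PoloidalWindowDoorPoloidalWindowRigidityWindow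
open Summit.NavierStokesRegularity.NavierStokesRegularity.Theorems.PoloidalWindowDoorPoloidalWindowRigidityTimeHeightShearLinearSlice
open Summit.NavierStokesRegularity.NavierStokesRegularity.Theorems.PoloidalWindowDoorPoloidalWindowRigidityConstantShearSlice
open Summit.NavierStokesRegularity.NavierStokesRegularity.Theorems.PoloidalWindowDoorLrcModEntireSheetFlattenTools
open Summit.NavierStokesRegularity.NavierStokesRegularity.Theorems.PoloidalWindowDoorLrcModEntireRidgeGlobalBranchODE
open Summit.NavierStokesRegularity.NavierStokesRegularity.Theorems.PoloidalWindowDoorLrcModEntireRidgeGlobalBranchFrame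
open Summit.NavierStokesRegularity.NavierStokesRegularity.Theorems.PoloidalWindowDoorLrcModEntirePlanarCurveRigidity
open Summit.NavierStokesRegularity.NavierStokesRegularity.Theorems.PoloidalWindowDoorLrcModEntireCurvedSheetTransport
open Summit.NavierStokesRegularity.NavierStokesRegularity.Theorems.PoloidalWindowDoorLrcModEntireCurvedSheetJet
open Summit.NavierStokesRegularity.NavierStokesRegularity.Theorems.PoloidalWindowDoorLrcModEntireRidgeClassConstants
open Summit.NavierStokesRegularity.NavierStokesRegularity.Theorems.PoloidalWindowDoorLrcModEntireCurvedSheetSpeedLaw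

variable {C : ℝ} {U : ℝ → EuclideanSpace ℝ (Fin 3) → EuclideanSpace ℝ (Fin 3)} {μ : ℝ → ℝ → ℝ} {ρ : ℝ} {Γ : ℝ → EuclideanSpace ℝ (Fin 3)} {k : ℝ → ℝ}

/-- ★ **JETS OF THE SLICE ON A VERTICAL CRITICAL CYLINDER.**  At `P = Γ s + z·e₂`, `|z| < ρ`, if the cylinder `Γ × (−ρ, ρ)` is horizontally critical for
`θ = U₂(−1,·)`: `D²θ[T,ν] = D²θ[T,T] = D²θ[e₂,ν] = 0`, `D³θ[ν,T,T] = −k·D²θ[ν,ν]`, `D³θ[ν,e₂,e₂] = 0`, and `μ(−1,z)·(D³θ[ν,T,T] + D³θ[ν,ν,ν]) = 0`. -/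
theorem vertical_cylinder_jets
    (hrate : HasTypeITimeDecay C U) (hcont : ContinuousOn (uncurry U) (Iio (0 : ℝ) ×ˢ univ))
    (hmild : ∀ s t : ℝ, s < t → t < 0 → ∀ x, U t x = heatExtension (U s) (t - s) x - oseenDuhamel 1 s U U t x)
    (hdiv : ∀ t < 0, VectorCalculus.IsDivFree (U t))
    (hμ3 : ContDiff ℝ 3 (uncurry μ)) (hρ : 0 < ρ)
    (hslabU : ∀ t : ℝ, |t + 1| < ρ → ∀ x : EuclideanSpace ℝ (Fin 3), |x 2| < ρ → ∀ b : Fin 3, b ≠ 2 →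
      fderiv ℝ (U t) x (EuclideanSpace.single 2 1) b = μ t (x 2) * fderiv ℝ (U t) x (EuclideanSpace.single b 1) 2)
    (hΓ : ContDiff ℝ 2 Γ) (hpl : ∀ s, Γ s 2 = 0) (hun : ∀ s, ‖deriv Γ s‖ = 1) (hk : ∀ s, deriv (deriv Γ) s = k s • rotJ (deriv Γ s))
    (hcrit : ∀ s z : ℝ, |z| < ρ → ∀ w : EuclideanSpace ℝ (Fin 3), w 2 = 0 → fderiv ℝ (fun y => U (-1) y 2) (Γ s + z • e2) w = 0)
    (s : ℝ) {z : ℝ} (hz : |z| < ρ) :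
    fderiv ℝ (fderiv ℝ (fun y => U (-1) y 2)) (Γ s + z • e2) (deriv Γ s) (rotJ (deriv Γ s)) = 0 ∧
    fderiv ℝ (fderiv ℝ (fun y => U (-1) y 2)) (Γ s + z • e2) (deriv Γ s) (deriv Γ s) = 0 ∧
    fderiv ℝ (fderiv ℝ (fun y => U (-1) y 2)) (Γ s + z • e2) e2 (rotJ (deriv Γ s)) = 0 ∧
    fderiv ℝ (fderiv ℝ (fderiv ℝ (fun y => U (-1) y 2))) (Γ s + z • e2) (rotJ (deriv Γ s)) (deriv Γ s) (deriv Γ s) =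
      -(k s * fderiv ℝ (fderiv ℝ (fun y => U (-1) y 2)) (Γ s + z • e2) (rotJ (deriv Γ s)) (rotJ (deriv Γ s))) ∧
    fderiv ℝ (fderiv ℝ (fderiv ℝ (fun y => U (-1) y 2))) (Γ s + z • e2) (rotJ (deriv Γ s)) e2 e2 = 0 ∧
    μ (-1) z * (fderiv ℝ (fderiv ℝ (fderiv ℝ (fun y => U (-1) y 2))) (Γ s + z • e2) (rotJ (deriv Γ s)) (deriv Γ s) (deriv Γ s) +
      fderiv ℝ (fderiv ℝ (fderiv ℝ (fun y => U (-1) y 2))) (Γ s + z • e2) (rotJ (deriv Γ s)) (rotJ (deriv Γ s)) (rotJ (deriv Γ s))) = 0 := by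
  have hm1 : (-1 : ℝ) < 0 := by norm_num
  have hm1ρ : |(-1 : ℝ) + 1| < ρ := by norm_num; exact hρ
  -- smoothness of the slice
  have hUan : AnalyticOnNhd ℝ (U (-1)) univ := analyticOnNhd_slice hcont (bdd_of_hasTypeITimeDecay hrate) hmild hm1
  have hU2 : ContDiff ℝ 2 (U (-1)) := hUan.contDiff
  have hθan : AnalyticOnNhd ℝ (fun y => U (-1) y 2) univ := fun x _ =>
    ((EuclideanSpace.proj (𝕜 := ℝ) (2 : Fin 3)).analyticAt _).comp (hUan x (mem_univ _))
  have hθ : ContDiff ℝ ∞ (fun y => U (-1) y 2) := hθan.contDiff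
  have hθ3 : ContDiff ℝ 3 (fun y => U (-1) y 2) := hθ.of_le (by norm_cast)
  have hT2 : ∀ s, deriv Γ s 2 = 0 := fun s => (deriv_horizontal hΓ hpl s).1
  have hν2 : ∀ s, rotJ (deriv Γ s) 2 = 0 := fun s => (rotJ_apply _).2.2
  -- the slab law of the class on `|x₂| < ρ`
  have hμfun : μ (-1) = uncurry μ ∘ fun z : ℝ => ((-1 : ℝ), z) := by funext z; rfl
  have hμd : ∀ z ∈ Ioo (-ρ) ρ, DifferentiableAt ℝ (μ (-1)) z := fun z _ => by
    rw [hμfun]; exact ((hμ3.differentiable (by norm_num)) _).comp z ((differentiableAt_const _).prodMk differentiableAt_id)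
  have hIρ : ∀ z ∈ Ioo (-ρ) ρ, |z| < ρ := fun z hz => abs_lt.2 ⟨hz.1, hz.2⟩
  have hplane : ∀ z : ℝ, |z| < ρ → ∀ y : EuclideanSpace ℝ (Fin 3), y 2 = z → ∀ b : Fin 3, b ≠ 2 →
      fderiv ℝ (U (-1)) y (EuclideanSpace.single 2 (1 : ℝ)) b = μ (-1) z * fderiv ℝ (U (-1)) y (EuclideanSpace.single b (1 : ℝ)) 2 := by
    intro z hz y hy b hb
    have h := hslabU (-1) hm1ρ y (by rw [hy]; exact hz) b hb; rw [hy] at h; exact h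
  have hlawI : ∀ x : EuclideanSpace ℝ (Fin 3), x 2 ∈ Ioo (-ρ) ρ →
      fderiv ℝ (fun y => fderiv ℝ (fun y' => U (-1) y' 2) y (EuclideanSpace.single 2 (1 : ℝ))) x (EuclideanSpace.single 2 (1 : ℝ)) =
        -μ (-1) (x 2) * (fderiv ℝ (fun y => fderiv ℝ (fun y' => U (-1) y' 2) y (EuclideanSpace.single 0 (1 : ℝ))) x (EuclideanSpace.single 0 (1 : ℝ)) +
          fderiv ℝ (fun y => fderiv ℝ (fun y' => U (-1) y' 2) y (EuclideanSpace.single 1 (1 : ℝ))) x (EuclideanSpace.single 1 (1 : ℝ))) :=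
    fun x hx => plane_wave_identity hU2 (fun y => div_coord (hdiv _ hm1) y) (hplane (x 2) (hIρ _ hx)) rfl
  -- the cylinder as a curved web with offset `d ≡ 0`
  have hJ : ∀ s : ℝ, ∀ z ∈ Ioo (-ρ) ρ, 1 - k s * (fun _ : ℝ => (0 : ℝ)) z ≠ 0 := fun s z _ => by simp
  have hν0 : ∀ s : ℝ, ∀ z ∈ Ioo (-ρ) ρ,
      fderiv ℝ (fun y => U (-1) y 2) (Γ s + (fun _ : ℝ => (0 : ℝ)) z • rotJ (deriv Γ s) + z • e2) (rotJ (deriv Γ s)) = 0 := by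
    intro s z hz; simp only [zero_smul, add_zero]; exact hcrit s z (hIρ z hz) _ (hν2 s)
  have hT0 : ∀ s : ℝ, ∀ z ∈ Ioo (-ρ) ρ,
      fderiv ℝ (fun y => U (-1) y 2) (Γ s + (fun _ : ℝ => (0 : ℝ)) z • rotJ (deriv Γ s) + z • e2) (deriv Γ s) = 0 := by
    intro s z hz; simp only [zero_smul, add_zero]; exact hcrit s z (hIρ z hz) _ (hT2 s)
  have hzI : z ∈ Ioo (-ρ) ρ := ⟨(abs_lt.1 hz).1, (abs_lt.1 hz).2⟩
  obtain ⟨h1, h2, h3, h4, -, h6, -⟩ := curved_sheet_jet hθ isOpen_Ioo (μ := μ (-1)) hμd (contDiffOn_const (c := (0 : ℝ))) hΓ hpl hun hk hJ hlawI hν0 hT0 s hzI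
  simp only [zero_smul, add_zero, mul_zero, sub_zero, one_mul, deriv_const, zero_mul, zero_add] at h1 h2 h3 h4 h6
  /- `D³θ[e₂,e₂,ν] = 0`: two `z`-derivatives of (E1) along the vertical line, then the slot symmetries -/
  have hline : ∀ z' : ℝ, HasDerivAt (fun z'' : ℝ => Γ s + z'' • e2) e2 z' := fun z' => by
    have h := ((hasDerivAt_id' z').smul_const e2).const_add (Γ s); rw [one_smul] at h; exact h
  have hD1d : Differentiable ℝ (fderiv ℝ (fun y => U (-1) y 2)) := (hθ3.fderiv_right (m := 2) (by norm_cast)).differentiable (by simp)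
  have hD2d : Differentiable ℝ (fderiv ℝ (fderiv ℝ (fun y => U (-1) y 2))) :=
    ((hθ3.fderiv_right (m := 2) (by norm_cast)).fderiv_right (m := 1) (by norm_cast)).differentiable (by simp)
  have hmem : Ioo (-ρ) ρ ∈ 𝓝 z := isOpen_Ioo.mem_nhds hzI
  -- first derivative: `D²θ(Γ s + z'·e₂)[e₂][ν] = 0` near `z`
  have hg : ∀ z' ∈ Ioo (-ρ) ρ, fderiv ℝ (fderiv ℝ (fun y => U (-1) y 2)) (Γ s + z' • e2) e2 (rotJ (deriv Γ s)) = 0 := by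
    intro z' hz'
    have hF : HasFDerivAt (fun y => fderiv ℝ (fun y' => U (-1) y' 2) y (rotJ (deriv Γ s)))
        ((ContinuousLinearMap.apply ℝ ℝ (rotJ (deriv Γ s))).comp (fderiv ℝ (fderiv ℝ (fun y => U (-1) y 2)) (Γ s + z' • e2))) (Γ s + z' • e2) :=
      (ContinuousLinearMap.apply ℝ ℝ (rotJ (deriv Γ s))).hasFDerivAt.comp _ (hD1d _).hasFDerivAt
    have hc := hF.comp_hasDerivAt z' (hline z')
    have hev : (fun z'' : ℝ => fderiv ℝ (fun y' => U (-1) y' 2) (Γ s + z'' • e2) (rotJ (deriv Γ s))) =ᶠ[𝓝 z'] fun _ => 0 := by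
      filter_upwards [isOpen_Ioo.mem_nhds hz'] with z'' hz'' using hcrit s z'' (hIρ z'' hz'') _ (hν2 s)
    have h0 : deriv (fun z'' : ℝ => fderiv ℝ (fun y' => U (-1) y' 2) (Γ s + z'' • e2) (rotJ (deriv Γ s))) z' = 0 := by
      rw [hev.deriv_eq, deriv_const]
    have h1' : deriv (fun z'' : ℝ => fderiv ℝ (fun y' => U (-1) y' 2) (Γ s + z'' • e2) (rotJ (deriv Γ s))) z' =
        ((ContinuousLinearMap.apply ℝ ℝ (rotJ (deriv Γ s))).comp (fderiv ℝ (fderiv ℝ (fun y => U (-1) y 2)) (Γ s + z' • e2))) e2 := hc.deriv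
    rw [h0] at h1'
    simpa using h1'.symm
  -- second derivative: `D³θ(P)[e₂][e₂][ν] = 0`
  have hh : fderiv ℝ (fderiv ℝ (fderiv ℝ (fun y => U (-1) y 2))) (Γ s + z • e2) e2 e2 (rotJ (deriv Γ s)) = 0 := by
    have hF : HasFDerivAt (fun y => fderiv ℝ (fderiv ℝ (fun y' => U (-1) y' 2)) y e2 (rotJ (deriv Γ s)))
        (fderiv ℝ (fun y => fderiv ℝ (fderiv ℝ (fun y' => U (-1) y' 2)) y e2 (rotJ (deriv Γ s))) (Γ s + z • e2)) (Γ s + z • e2) :=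
      (((hD2d _).clm_apply (differentiableAt_const e2)).clm_apply (differentiableAt_const _)).hasFDerivAt
    have hc := hF.comp_hasDerivAt z (hline z)
    have hev : (fun z'' : ℝ => fderiv ℝ (fderiv ℝ (fun y' => U (-1) y' 2)) (Γ s + z'' • e2) e2 (rotJ (deriv Γ s))) =ᶠ[𝓝 z] fun _ => 0 := by
      filter_upwards [hmem] with z'' hz'' using hg z'' hz''
    have h0 : deriv (fun z'' : ℝ => fderiv ℝ (fderiv ℝ (fun y' => U (-1) y' 2)) (Γ s + z'' • e2) e2 (rotJ (deriv Γ s))) z = 0 := by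
      rw [hev.deriv_eq, deriv_const]
    have h1' : deriv (fun z'' : ℝ => fderiv ℝ (fderiv ℝ (fun y' => U (-1) y' 2)) (Γ s + z'' • e2) e2 (rotJ (deriv Γ s))) z =
        fderiv ℝ (fun y => fderiv ℝ (fderiv ℝ (fun y' => U (-1) y' 2)) y e2 (rotJ (deriv Γ s))) (Γ s + z • e2) e2 := hc.deriv
    rw [h0, fderiv_hessian_apply_const hθ3] at h1'
    exact h1'.symm
  have h5 : fderiv ℝ (fderiv ℝ (fderiv ℝ (fun y => U (-1) y 2))) (Γ s + z • e2) (rotJ (deriv Γ s)) e2 e2 = 0 := by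
    rw [fderiv3_swap12 hθ3, fderiv3_swap23 hθ3]; exact hh
  refine ⟨h1, h2, ?_, by linarith [h4], h5, ?_⟩
  · -- `D²θ[e₂,ν] = 0` is `hg` at `z`
    exact hg z hzI
  · rw [h5, zero_add] at h6
    exact h6

/-- ★★ **VERT-PROP, ORDER 1: on a vertical critical cylinder `∂_ν(∂_tU₂) = −(Uₕ·ν)·D²θ[ν,ν]`** (so a time web through it moves with speed `Uₕ·ν`).  Hypotheses as
in `vertical_cylinder_jets`, plus `μ(−1,z) ≠ 1` and `μ(−1,z) ≠ 0` at the height considered. -/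
theorem vertical_order_one
    (hrate : HasTypeITimeDecay C U) (hcont : ContinuousOn (uncurry U) (Iio (0 : ℝ) ×ˢ univ))
    (hmild : ∀ s t : ℝ, s < t → t < 0 → ∀ x, U t x = heatExtension (U s) (t - s) x - oseenDuhamel 1 s U U t x)
    (hdiv : ∀ t < 0, VectorCalculus.IsDivFree (U t))
    (hpol : ∀ s < 0, ∀ y, ⟪curl (U s) y, EuclideanSpace.single 2 1⟫_ℝ = 0)
    (hμ3 : ContDiff ℝ 3 (uncurry μ)) (hρ : 0 < ρ)
    (hslabU : ∀ t : ℝ, |t + 1| < ρ → ∀ x : EuclideanSpace ℝ (Fin 3), |x 2| < ρ → ∀ b : Fin 3, b ≠ 2 →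
      fderiv ℝ (U t) x (EuclideanSpace.single 2 1) b = μ t (x 2) * fderiv ℝ (U t) x (EuclideanSpace.single b 1) 2)
    (hΓ : ContDiff ℝ 2 Γ) (hpl : ∀ s, Γ s 2 = 0) (hun : ∀ s, ‖deriv Γ s‖ = 1) (hk : ∀ s, deriv (deriv Γ) s = k s • rotJ (deriv Γ s))
    (hcrit : ∀ s z : ℝ, |z| < ρ → ∀ w : EuclideanSpace ℝ (Fin 3), w 2 = 0 → fderiv ℝ (fun y => U (-1) y 2) (Γ s + z • e2) w = 0)
    (s : ℝ) {z : ℝ} (hz : |z| < ρ) (hμ1 : μ (-1) z ≠ 1) (hμ0 : μ (-1) z ≠ 0) :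
    fderiv ℝ (fun x => deriv (fun s' => U s' x 2) (-1)) (Γ s + z • e2) (rotJ (deriv Γ s)) =
      -(⟪U (-1) (Γ s + z • e2), rotJ (deriv Γ s)⟫ *
        fderiv ℝ (fderiv ℝ (fun y => U (-1) y 2)) (Γ s + z • e2) (rotJ (deriv Γ s)) (rotJ (deriv Γ s))) := by
  have hT2 : ∀ s, deriv Γ s 2 = 0 := fun s => (deriv_horizontal hΓ hpl s).1
  have hν2 : ∀ s, rotJ (deriv Γ s) 2 = 0 := fun s => (rotJ_apply _).2.2
  have hIρ : ∀ z ∈ Ioo (-ρ) ρ, |z| < ρ := fun z hz => abs_lt.2 ⟨hz.1, hz.2⟩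
  have hzI : z ∈ Ioo (-ρ) ρ := ⟨(abs_lt.1 hz).1, (abs_lt.1 hz).2⟩
  -- the jets on the cylinder
  obtain ⟨-, -, -, h4, -, h6⟩ := vertical_cylinder_jets hrate hcont hmild hdiv hμ3 hρ hslabU hΓ hpl hun hk hcrit s hz
  have hsum : fderiv ℝ (fderiv ℝ (fderiv ℝ (fun y => U (-1) y 2))) (Γ s + z • e2) (rotJ (deriv Γ s)) (rotJ (deriv Γ s)) (rotJ (deriv Γ s)) =
      k s * fderiv ℝ (fderiv ℝ (fun y => U (-1) y 2)) (Γ s + z • e2) (rotJ (deriv Γ s)) (rotJ (deriv Γ s)) := by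
    have h := (mul_eq_zero.1 h6).resolve_left hμ0
    linarith
  -- B-SPEEDc with `d ≡ 0` at `τ = 0`
  have hJ : ∀ s : ℝ, ∀ z ∈ Ioo (-ρ) ρ, 1 - k s * (fun _ : ℝ => (0 : ℝ)) z ≠ 0 := fun s z _ => by simp
  have hν0 : ∀ s : ℝ, ∀ z ∈ Ioo (-ρ) ρ,
      fderiv ℝ (fun y => U (-1 + 0) y 2) (Γ s + (fun _ : ℝ => (0 : ℝ)) z • rotJ (deriv Γ s) + z • e2) (rotJ (deriv Γ s)) = 0 := by
    intro s z hz; simp only [zero_smul, add_zero]; exact hcrit s z (hIρ z hz) _ (hν2 s)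
  have hT0 : ∀ s : ℝ, ∀ z ∈ Ioo (-ρ) ρ,
      fderiv ℝ (fun y => U (-1 + 0) y 2) (Γ s + (fun _ : ℝ => (0 : ℝ)) z • rotJ (deriv Γ s) + z • e2) (deriv Γ s) = 0 := by
    intro s z hz; simp only [zero_smul, add_zero]; exact hcrit s z (hIρ z hz) _ (hT2 s)
  have hμ1' : μ (-1 + 0) z ≠ 1 := by simpa using hμ1
  have h := curved_sheet_normalDeriv_timeDeriv hrate hcont hmild hdiv hpol hμ3 hslabU (τ := 0) (by norm_num) (by simpa using hρ) hΓ hpl hun hk isOpen_Ioo hIρ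
    (contDiffOn_const (c := (0 : ℝ))) hJ hν0 hT0 s hzI hμ1'
  simp only [zero_smul, add_zero, mul_zero, sub_zero, one_mul, deriv_const, zero_mul, zero_div] at h
  rw [h, hsum]
  ring

end Summit.NavierStokesRegularity.NavierStokesRegularity.Theorems.PoloidalWindowDoorLrcModEntireQ4CurvedVerticalOrderOne

end
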